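import Mathlib
import Literature.Computability.Complexity.SymmetricCircuit

/-!
# "Hard to identify" — the intermediate core between (★) CoreFooling and TwinIsoHard
(crux `SymmetryBudget.WindowBarrier`, item stmt-PneNP-2145, line `bijection-gauge-twin-iso`, stub S_H)

`HardToIdentify` (HTI): for every rate `c`, for infinitely many `h`, SOME `h`-vertex graph `H` has no
`Sym(Fin h)`-symmetric `tcBasis`-circuit with at most `2^{ch}` gates computing the indicator
`G ↦ [G ≅ H]` of its isomorphism class on adjacency matrices.

It sits between the two open cores on file:
(★) CoreFooling (fooling PAIRS, hypothesis of the landed `stub_coreReduction`) ⟹ HTI (this file,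
pure logic: an identifier of `G₁` separates the fooling pair) ⟹ TwinIsoHard (planting `H` on one free half:
the relocation of `stub_twinIsoHard_of_coreFooling` with `G₁ := H`, recorded in a later file once that
stub is in the tree). Neither converse is known: ¬HTI (every `H` identifiable at rate `c`) gives twin
isomorphism only as an OR over `2^{Θ(h²)}` isomorphism classes, and ¬(★) (pair-DEPENDENT separators)
gives an identifier only as an AND over `2^{Θ(h²)}` partners.
-/

-- `Summit.PneNP.PneNP.…` duplicates `PneNP` BY DESIGN (single-problem summit, D-0017).
set_option linter.dupNamespace false

namespace Summit.PneNP.PneNP.Theorems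

open Literature.Computability.Complexity Filter
open scoped Classical

/-- The graph read off the adjacency matrix of `G` is `G` itself (`fromRel` symmetrises and drops the
diagonal, both vacuous for a simple graph). [folklore] -/
theorem fromRel_adj_decide_eq {h : ℕ} (G : SimpleGraph (Fin h)) :
    (SimpleGraph.fromRel fun u v => decide (G.Adj u v) = true) = G := by
  ext u v
  simp only [SimpleGraph.fromRel_adj, decide_eq_true_eq]
  constructor
  · rintro ⟨-, h₁ | h₁⟩
    · exact h₁
    · exact h₁.symm
  · intro huv
    exact ⟨G.ne_of_adj huv, Or.inl huv⟩

/-- **(★) CoreFooling ⟹ HardToIdentify.** If for every `d`, infinitely often two non-isomorphic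
`g`-vertex graphs fool every `Sym(Fin g)`-symmetric `tcBasis`-circuit with at most `2^{dg}` gates, then
for every `c`, infinitely often some `h`-vertex graph `H` (namely the first graph of a fooling pair) has
NO `Sym(Fin h)`-symmetric `tcBasis`-circuit of size `≤ 2^{ch}` computing `x ↦ [Gr x ≅ H]`: such a circuit
outputs `true` on the adjacency matrix of `H = G₁` and `false` on that of `G₂ ≇ G₁`, contradicting the
fooling clause. Pure logic over `HasSymCircuit`; no circuit is moved. -/
theorem hardToIdentify_of_coreFooling :
    (∀ d : ℕ, ∃ᶠ g in atTop, ∃ G₁ G₂ : SimpleGraph (Fin g), ¬ Nonempty (G₁ ≃g G₂) ∧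
      ∀ C : Circuit (Fin g × Fin g), C.IsOver tcBasis → C.size ≤ 2 ^ (d * g) →
        C.IsSymmetricUnder Set.univ →
          C.eval (fun p : Fin g × Fin g => decide (G₁.Adj p.1 p.2)) =
            C.eval (fun p : Fin g × Fin g => decide (G₂.Adj p.1 p.2))) →
    ∀ c : ℕ, ∃ᶠ h in atTop, ∃ H : SimpleGraph (Fin h),
      ¬ HasSymCircuit tcBasis Set.univ (2 ^ (c * h))
        (fun x : Fin h × Fin h → Bool =>
          decide (Nonempty ((SimpleGraph.fromRel fun u v => x (u, v) = true) ≃g H))) := by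
  intro hcore c
  refine (hcore c).mono ?_
  rintro h ⟨G₁, G₂, hne, hfool⟩
  refine ⟨G₁, ?_⟩
  rintro ⟨C, hO, hs, hsym, hcomp⟩
  have h₁ := hcomp (fun p : Fin h × Fin h => decide (G₁.Adj p.1 p.2))
  have h₂ := hcomp (fun p : Fin h × Fin h => decide (G₂.Adj p.1 p.2))
  have hfr₁ : (SimpleGraph.fromRel fun u v =>
      (fun p : Fin h × Fin h => decide (G₁.Adj p.1 p.2)) (u, v) = true) = G₁ :=
    fromRel_adj_decide_eq G₁
  have hfr₂ : (SimpleGraph.fromRel fun u v =>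
      (fun p : Fin h × Fin h => decide (G₂.Adj p.1 p.2)) (u, v) = true) = G₂ :=
    fromRel_adj_decide_eq G₂
  simp only [] at h₁ h₂
  rw [hfr₁] at h₁
  rw [hfr₂] at h₂
  have heq := hfool C hO hs hsym
  rw [h₁, h₂] at heq
  have ht : decide (Nonempty (G₁ ≃g G₁)) = true := decide_eq_true ⟨SimpleGraph.Iso.refl⟩
  have hf : decide (Nonempty (G₂ ≃g G₁)) = false :=
    decide_eq_false fun ⟨e⟩ => hne ⟨e.symm⟩
  rw [ht, hf] at heq
  exact Bool.noConfusion heq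

end Summit.PneNP.PneNP.Theorems
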